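import Summits.HubbardSuperconductivity.HubbardLadder.Bounds.TwistedFluxCoupling
import HarnessLib

/-!
# The twisted `t–t'` torus in Ueltschi's bond algebra: `Z(β, θ) = Zc(β, U, μ; c_θ)`
# (pub-hubbard BOUNDS, Theorem 12 — dictionary step, KERNEL-PROVED)

LINT.SIZE SPLIT (bounds g25 amendment 2026-08-21, same request number #181.3): the sections
`Indicator` and the first half of `Torus` (coupling function, seam phases) of the original #181.3
file now live in `Bounds/TwistedFluxCoupling.lean` (#181.3a), imported here; every declaration is
byte-identical to the staged v1 and in the original order.

HONEST FRAMING: ladder R1–R4 with certified numbers; no claim on H/H₀. Rigorous statements about a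
MODEL CLASS (the `t–t'` Hubbard torus with on-site interaction), no materials claim.

Cell tree `Summits/HubbardSuperconductivity/HubbardLadder/Bounds/` (programme-internal; nothing
here is a cited Literature fact). bounds.tex §12 (bounds g23, 2026-08-21), Lemma 12.2 (polymer
representation for bond-dependent couplings) needs, as its zeroth step, the grand-canonical
partition function of the seam-twisted `t–t'` torus `hubbardTorusTT'Flux L t' U θ - μ N`
(`Literature…HubbardNNNHoppingFlux`, the Hamiltonian of the node
`HighTemperatureTwistInsensitivityTT'` of `Bounds/HighTemperatureNoStiffness.lean`) written as
Ueltschi's generalised Gibbs factor `Zc(β, U, μ; c) = Tr exp(-β V_Λ + Σ_b c_b T_b)`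
(`Literature…HubbardBondAlgebra.Zc`) with an EXPLICIT bond coupling `c = ttFluxCoupling L β t' θ`
on the directed spin-bonds `b = (x, y, σ)`: `β e^{iθ·[seam]}` on `y → y + e₁`, `β` on
`y → y + e₂`, `β t' e^{iθ·[seam]}` on the two diagonal jumps `y → y + e₁ ± e₂`, the complex
conjugates on the reversed bonds, `0` elsewhere (`[seam]` = the source column is `x₁ = -1`). This
file proves that identity (`partitionFn_hubbardTorusTT'FluxMu_eq_Zc`, `L ≥ 3`) from the tree's
Peierls forms `hubbardTorusFlux_eq_magneticHubbardTorus` and `hamiltonianDiag_add_smul_diagSeamTwist`.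
Together with the column gauge lemma (`Bounds/ColumnGaugeLemma.lean`, LEAN FILING REQUEST #181.2)
it is the complete MODEL-SPECIFIC input of bounds.tex Theorem 12; what remains for the node is the
generic cluster-expansion tail estimate (tree: `HubbardPolymerRepresentation`, `ClusterExpansion`).

Main results (0 sorry):
* `hopSum_indicatorCoupling` — `Σ_b (Σ_j [b = a_j] r_j) T_b = Σ_j r_j T_{a_j}` (bookkeeping);
* `onSiteSum_univ_eq_smul_sub` — `V_Λ = U Σ_y n_{y↑} n_{y↓} - μ N`;
* `partitionFn_hubbardTorusTT'FluxMu_eq_Zc` — the dictionary, `L ≥ 3`, all real `β, t', U, μ, θ`.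

References: Ueltschi, arXiv:cond-mat/9810320 §2.1, §3 (the bond algebra `T_𝐀`, `Zc`); Watanabe,
J. Stat. Phys. 177 (2019) 717, §2.2.3 (seam gauge); Xu–Chung–Qin–Schollwöck–White–Zhang, Science 384
(2024) eadh7691, eq. (1) (the `t–t'` Hamiltonian); Scalapino–White–Zhang, PRB 47 (1993) 7995 (flux /
Drude weight).
-/

namespace Summit.HubbardSuperconductivity.HubbardLadder.Bounds

open Matrix Literature.MathematicalPhysics.QuantumLattice
  Literature.MathematicalPhysics.QuantumFieldTheory
open scoped ComplexConjugate

section Torus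

variable {L : ℕ} [NeZero L]

/-- **Factorisation (bounds.tex Lemma 12.5, the cocycle).** The twisted coupling is the untwisted one
multiplied by the seam phase of the bond: `c_θ(b) = ω_θ(b) c_0(b)` (`L ≥ 3`).
[programme: bounds.tex §12, Lemma 12.5] -/
theorem ttFluxCoupling_eq_seamPhase_mul (hL : 3 ≤ L) (β t' θ : ℝ) (b : Bond (FermionTorus 2 L)) :
    ttFluxCoupling L β t' θ b = seamPhase L θ b.1 b.2.1 * ttFluxCoupling L β t' 0 b := by
  have h1 : ∀ j : Site 2 L × Fin 2 × Fin 2, (β : ℂ) * seamAmp L θ j.1 j.2.1 =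
      seamPhase L θ (nnFwdBond L j).1 (nnFwdBond L j).2.1 * ((β : ℂ) * seamAmp L 0 j.1 j.2.1) := by
    rintro ⟨x, i, σ⟩
    simp only [nnFwdBond, seamAmp_flux_zero, mul_one]
    rcases (show ∀ j : Fin 2, j = 0 ∨ j = 1 by decide) i with rfl | rfl
    · rw [seamAmp_dir_zero, seamPhase_of_col_succ hL θ (x 0) _ _
        (by rw [col_ofTorusSite, shift_zero_apply_zero]) (col_ofTorusSite x)]
      split_ifs <;> ring
    · rw [seamAmp_dir_one, seamPhase_of_col_eq hL θ (x 0) _ _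
        (by rw [col_ofTorusSite, shift_one_apply_zero]) (col_ofTorusSite x)]
      ring
  have h2 : ∀ j : Site 2 L × Fin 2 × Fin 2, (β : ℂ) * conj (seamAmp L θ j.1 j.2.1) =
      seamPhase L θ (nnBwdBond L j).1 (nnBwdBond L j).2.1 *
        ((β : ℂ) * conj (seamAmp L 0 j.1 j.2.1)) := by
    rintro ⟨x, i, σ⟩
    simp only [nnBwdBond, seamAmp_flux_zero, map_one, mul_one]
    rcases (show ∀ j : Fin 2, j = 0 ∨ j = 1 by decide) i with rfl | rfl
    · rw [conj_seamAmp_dir_zero, seamPhase_of_col_succ' hL θ (x 0) _ _ (col_ofTorusSite x)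
        (by rw [col_ofTorusSite, shift_zero_apply_zero])]
      split_ifs <;> ring
    · rw [seamAmp_dir_one, map_one, seamPhase_of_col_eq hL θ (x 0) _ _ (col_ofTorusSite x)
        (by rw [col_ofTorusSite, shift_one_apply_zero])]
      ring
  have hdiag : ∀ (s : Fin 2) (x : Site 2 L),
      col (FermionTorus.ofTorusSite (x + torusDiagJump L s)) = (x 0 + 1).val := by
    intro s x
    rw [col_ofTorusSite, Pi.add_apply, show torusDiagJump L s 0 = 1 from by simp [torusDiagJump]]
  have h3 : ∀ j : Fin 2 × Site 2 L × Fin 2, (β : ℂ) * (t' : ℂ) * seamAmp L θ j.2.1 0 =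
      seamPhase L θ (diagFwdBond L j).1 (diagFwdBond L j).2.1 *
        ((β : ℂ) * (t' : ℂ) * seamAmp L 0 j.2.1 0) := by
    rintro ⟨s, x, σ⟩
    simp only [diagFwdBond, seamAmp_flux_zero, mul_one]
    rw [seamAmp_dir_zero, seamPhase_of_col_succ hL θ (x 0) _ _ (hdiag s x) (col_ofTorusSite x)]
    split_ifs <;> ring
  have h4 : ∀ j : Fin 2 × Site 2 L × Fin 2, (β : ℂ) * (t' : ℂ) * conj (seamAmp L θ j.2.1 0) =
      seamPhase L θ (diagBwdBond L j).1 (diagBwdBond L j).2.1 *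
        ((β : ℂ) * (t' : ℂ) * conj (seamAmp L 0 j.2.1 0)) := by
    rintro ⟨s, x, σ⟩
    simp only [diagBwdBond, seamAmp_flux_zero, map_one, mul_one]
    rw [conj_seamAmp_dir_zero, seamPhase_of_col_succ' hL θ (x 0) _ _ (col_ofTorusSite x) (hdiag s x)]
    split_ifs <;> ring
  simp only [ttFluxCoupling, Pi.add_apply]
  rw [indicatorCoupling_phase_mul _ _ _ _ h1 b, indicatorCoupling_phase_mul _ _ _ _ h2 b,
    indicatorCoupling_phase_mul _ _ _ _ h3 b, indicatorCoupling_phase_mul _ _ _ _ h4 b]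
  ring

/-- `(a + 1, a)` columns are cyclically adjacent. [folklore] -/
theorem zmod_val_succ_cases (hL : 2 ≤ L) (a : ZMod L) :
    (a + 1).val = a.val + 1 ∨ ((a + 1).val = 0 ∧ a.val = L - 1) := by
  by_cases ha : a = -1
  · right
    subst ha
    have hv1 : (-1 : ZMod L).val = L - 1 := by
      have h := (zmod_eq_neg_one_iff_val (-1 : ZMod L)).mp rfl; omega
    rw [neg_add_cancel, ZMod.val_zero, hv1]
    exact ⟨rfl, rfl⟩
  · exact Or.inl (zmod_val_add_one_of_ne_neg_one hL ha)

/-- **Support (bounds.tex Lemma 12.5, the hypothesis).** A bond carrying a nonzero `t–t'` coupling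
joins equal or cyclically adjacent columns (`L ≥ 3`). [programme: bounds.tex §12] -/
theorem ttFluxCoupling_col_adjacent (hL : 3 ≤ L) (β t' θ : ℝ) (b : Bond (FermionTorus 2 L))
    (hb : ttFluxCoupling L β t' θ b ≠ 0) :
    col b.1 = col b.2.1 ∨ col b.1 = col b.2.1 + 1 ∨ col b.2.1 = col b.1 + 1 ∨
      (col b.1 = 0 ∧ col b.2.1 = L - 1) ∨ (col b.1 = L - 1 ∧ col b.2.1 = 0) := by
  by_contra hrel
  apply hb
  have hL2 : 2 ≤ L := by omega
  have fwd : ∀ (u v : FermionTorus 2 L) (σ : Fin 2) (a : ZMod L), col u = (a + 1).val →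
      col v = a.val → b ≠ (u, v, σ) := by
    rintro u v σ a hu hv rfl
    rcases zmod_val_succ_cases hL2 a with h | ⟨h0, h1⟩
    · exact hrel (Or.inr (Or.inl (by simp only; omega)))
    · exact hrel (Or.inr (Or.inr (Or.inr (Or.inl ⟨by simp only; omega, by simp only; omega⟩))))
  have bwd : ∀ (u v : FermionTorus 2 L) (σ : Fin 2) (a : ZMod L), col u = a.val →
      col v = (a + 1).val → b ≠ (u, v, σ) := by
    rintro u v σ a hu hv rfl
    rcases zmod_val_succ_cases hL2 a with h | ⟨h0, h1⟩
    · exact hrel (Or.inr (Or.inr (Or.inl (by simp only; omega))))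
    · exact hrel (Or.inr (Or.inr (Or.inr (Or.inr ⟨by simp only; omega, by simp only; omega⟩))))
  have vert : ∀ (u v : FermionTorus 2 L) (σ : Fin 2) (a : ZMod L), col u = a.val →
      col v = a.val → b ≠ (u, v, σ) := by
    rintro u v σ a hu hv rfl
    exact hrel (Or.inl (by simp only; omega))
  have hdiag : ∀ (s : Fin 2) (x : Site 2 L),
      col (FermionTorus.ofTorusSite (x + torusDiagJump L s)) = (x 0 + 1).val := by
    intro s x
    rw [col_ofTorusSite, Pi.add_apply, show torusDiagJump L s 0 = 1 from by simp [torusDiagJump]]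
  simp only [ttFluxCoupling, Pi.add_apply]
  rw [indicatorCoupling_eq_zero, indicatorCoupling_eq_zero, indicatorCoupling_eq_zero,
    indicatorCoupling_eq_zero, add_zero, add_zero, add_zero]
  · rintro ⟨s, x, σ⟩
    exact bwd _ _ σ (x 0) (col_ofTorusSite x) (hdiag s x)
  · rintro ⟨s, x, σ⟩
    exact fwd _ _ σ (x 0) (hdiag s x) (col_ofTorusSite x)
  · rintro ⟨x, i, σ⟩
    rcases (show ∀ j : Fin 2, j = 0 ∨ j = 1 by decide) i with rfl | rfl
    · exact bwd _ _ σ (x 0) (col_ofTorusSite x) (by rw [col_ofTorusSite, shift_zero_apply_zero])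
    · exact vert _ _ σ (x 0) (col_ofTorusSite x) (by rw [col_ofTorusSite, shift_one_apply_zero])
  · rintro ⟨x, i, σ⟩
    rcases (show ∀ j : Fin 2, j = 0 ∨ j = 1 by decide) i with rfl | rfl
    · exact fwd _ _ σ (x 0) (by rw [col_ofTorusSite, shift_zero_apply_zero]) (col_ofTorusSite x)
    · exact vert _ _ σ (x 0) (by rw [col_ofTorusSite, shift_one_apply_zero]) (col_ofTorusSite x)

/-! ### Node: twist-blindness of the activities on column-missing supports -/

/-- **Node (bounds.tex Lemma 12.5 applied to the `t–t'` torus; PROVED below).** For every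
`L ≥ 3`, all real `β, t', U, μ, θ`, every column `k < L` and every set of sites `A` missing
column `k`, the generalised Gibbs factor of the twisted coupling RESTRICTED TO THE BONDS INSIDE `A`
equals the untwisted one: `Zc(β,U,μ; c_θ|_A) = Zc(β,U,μ; c_0|_A)`. These restricted factors are
the building blocks of the polymer activities `ρ(A)` of bounds.tex Lemma 12.2 (Ueltschi 1999
§2.3), so every activity of a column-missing polymer is twist-blind.
[programme: bounds.tex §12, Lemma 12.5; programme node, proved in this file] -/
@[conjecture] def TwistedTorusColumnBlindActivities : Prop :=
  ∀ (L : ℕ) [NeZero L], 3 ≤ L → ∀ (β t' U μ θ : ℝ) (k : ℕ), k < L →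
    ∀ (A : Finset (FermionTorus 2 L)), (∀ x ∈ A, col x ≠ k) →
      Zc (β : ℂ) (U : ℂ) (μ : ℂ)
          (fun b => if b.1 ∈ A ∧ b.2.1 ∈ A then ttFluxCoupling L β t' θ b else 0) =
        Zc (β : ℂ) (U : ℂ) (μ : ℂ)
          (fun b => if b.1 ∈ A ∧ b.2.1 ∈ A then ttFluxCoupling L β t' 0 b else 0)

/-- **Twist-blindness of restricted couplings** (any bond predicate avoiding column `k`).
[programme: bounds.tex §12, Lemma 12.5] -/
theorem Zc_restrict_ttFluxCoupling_eq (hL : 3 ≤ L) (β t' U μ θ : ℝ) {k : ℕ} (hk : k < L)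
    (keep : Bond (FermionTorus 2 L) → Prop) [DecidablePred keep]
    (hkeep : ∀ b, keep b → col b.1 ≠ k ∧ col b.2.1 ≠ k) :
    Zc (β : ℂ) (U : ℂ) (μ : ℂ) (fun b => if keep b then ttFluxCoupling L β t' θ b else 0) =
      Zc (β : ℂ) (U : ℂ) (μ : ℂ) (fun b => if keep b then ttFluxCoupling L β t' 0 b else 0) := by
  have hfac : (fun b => if keep b then ttFluxCoupling L β t' θ b else 0) =
      fun b => seamPhase L θ b.1 b.2.1 * (if keep b then ttFluxCoupling L β t' 0 b else 0) := by
    funext b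
    rw [ttFluxCoupling_eq_seamPhase_mul hL]
    split_ifs
    · rfl
    · rw [mul_zero]
  rw [hfac]
  refine columnGaugeTwistBlindness_holds L hL θ k hk _ _ _
    (fun b => if keep b then ttFluxCoupling L β t' 0 b else 0) fun b hb => ?_
  by_cases hkb : keep b
  · simp only [if_pos hkb] at hb
    exact ⟨(hkeep b hkb).1, (hkeep b hkb).2, ttFluxCoupling_col_adjacent hL β t' 0 b hb⟩
  · simp only [if_neg hkb, ne_eq, not_true_eq_false] at hb

/-- **The node holds.** [programme: bounds.tex §12, Lemma 12.5 — KERNEL-PROVED] -/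
theorem twistedTorusColumnBlindActivities_holds : TwistedTorusColumnBlindActivities := by
  intro L _ hL β t' U μ θ k hk A hA
  exact Zc_restrict_ttFluxCoupling_eq hL β t' U μ θ hk (fun b => b.1 ∈ A ∧ b.2.1 ∈ A)
    fun b hb => ⟨hA _ hb.1, hA _ hb.2⟩

/-! ### Node: the dictionary -/

/-- **Node (bounds.tex Lemma 12.2, step 0; PROVED below).** The grand-canonical partition function
of the seam-twisted `t–t'` torus is Ueltschi's generalised Gibbs factor of `ttFluxCoupling`.
[programme: bounds.tex §12; programme node, proved in this file] -/
@[conjecture] def TwistedTorusBondDictionary : Prop :=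
  ∀ (L : ℕ) [NeZero L], 3 ≤ L → ∀ (β t' U μ θ : ℝ),
    (hubbardTorusTT'Flux L t' U θ - (μ : ℂ) • totalNumber).partitionFn β =
      Zc (β : ℂ) (U : ℂ) (μ : ℂ) (ttFluxCoupling L β t' θ)

/-- **The node holds.** [programme: bounds.tex §12 — KERNEL-PROVED] -/
theorem twistedTorusBondDictionary_holds : TwistedTorusBondDictionary :=
  fun _ _ hL β t' U μ θ => partitionFn_hubbardTorusTT'FluxMu_eq_Zc hL β t' U μ θ

end Torus

end Summit.HubbardSuperconductivity.HubbardLadder.Bounds
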